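import Literature.NumberTheory.LFunctions.Zhang2022.Section8XiDipoleTaylor
import Literature.NumberTheory.LFunctions.Zhang2022.Section8XiZeroTailMean
import Literature.NumberTheory.LFunctions.Zhang2022.Section8PerronSteps
import HarnessLib

/-!
# Zhang (2022) §8: SUPPLIERS for the anti-side row — the pointwise Lemma-8.4 input `hE` of `DipoleRule.antiRow_C2` from the
# tree's `Skeleton.Lemma84Rel` reading, and the low-range input `hB` from the absolute logarithmic mean of `ξ₀ⱼ`

Topic `Literature/NumberTheory/LFunctions/Zhang2022` (Landau–Siegel audit tree; verdict-neutral). Y. Zhang, *Discrete mean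
estimates and the Landau–Siegel zero*, arXiv:2211.02515v1 (2022) [Zhang2022LandauSiegel] — **an unrefereed manuscript
under adjudication; nothing here asserts or denies its Theorems 1–2; no claim about Landau–Siegel zeros.** Cell
landau-siegel §D, crux K0 = stmt-Parity-20459 (row (S)), prover ls-knife-K0-p1 g0. The anti-side row
(`Section8XiDipoleProfile.antiRow_C2`) displays two pointwise analytic inputs; this file shows how they are MET at a fixed
modulus: `hE` (on `[τ, Z]`) is the Lemma-8.4 reading at `y = e^{sΛ}` (`xiRieszMean_sub_le_of_lemma84`: the main-term profile
`𝔤_{jμ}(e^{sΛ})` IS `gProfile A C γ s` with Zhang's constants, `frakg_eq_gProfile`; the range needs `T < e^{τΛ}` and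
`e^{ZΛ} < P`), and `hB` (on `[0, τ]`) is the trivial bound of the twisted Riesz mean by the absolute logarithmic mean of
`ξ₀ⱼ` (`norm_xiRieszMean_le`: `‖R^ξ(y)‖ ≤ log y·Σ_{n<⌈y⌉}|ξ₀ⱼ(n;d,r)|/n` for `y ≥ 1`, purely imaginary `β_μ`), which the
tree bounds by `C𝓛(1+log y)³` on `[1,T]` (`XiZeroTailMean.xiZeroTailMean`), plus `‖gProfile A C γ s‖ ≤ ‖A‖ + ‖1−A‖ + ‖C‖s`
for purely imaginary `γ` (`norm_gProfile_le`).

## References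
* Y. Zhang, arXiv:2211.02515v1 (2022), §8 Lemmas 8.3–8.4, p. 17; §8 p. 47 (display before (8.10)).
  [cite: Zhang2022LandauSiegel, §8 Lemma 8.4]
-/

noncomputable section

open Complex Real Finset MeasureTheory intervalIntegral Set
open scoped ComplexConjugate

namespace Literature.NumberTheory.LFunctions.Zhang2022.DipoleRule

open Skeleton

variable {c' : ℝ} {D : ℕ} [NeZero D] {χ : DirichletCharacter ℂ D}

/-! ### `hE`: Lemma 8.4 pointwise, in the height variable -/

/-- `𝔤_{jμ}(e^{sΛ}) = gProfile A C γ s` with Zhang's constants `A = β′β″/β_μ²`, `C = −(β′−β_μ)(β″−β_μ)Λ/β_μ`, `γ = β_μΛ`.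
[cite: Zhang2022LandauSiegel, §8 Lemma 8.4] -/
theorem frakgW_exp_eq_gProfile (c' : ℝ) (D : ℕ) (j μ : ℕ) (Λ s : ℝ) :
    frakgW c' D j μ (Real.exp (s * Λ))
      = gProfile (betaJ c' D (j + 1) * betaJ c' D (j + 2) / betaMu D μ ^ 2)
          (-((betaJ c' D (j + 1) - betaMu D μ) * (betaJ c' D (j + 2) - betaMu D μ)) * Λ / betaMu D μ)
          (betaMu D μ * Λ) s := by
  unfold frakgW
  rw [Real.log_exp]
  push_cast
  exact frakg_eq_gProfile _ _ _ Λ s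

/-- **Supplier of `hE`:** if the Lemma-8.4 reading holds at every `y ∈ (T, P)` with error `E₀` (the fixed-modulus content
of `Skeleton.Lemma84Rel c′` at `j, μ, d, r`), then for heights `s ∈ [τ, Z]` with `T < e^{τΛ}` and `e^{ZΛ} < P`
(`Λ > 0`): `‖R^ξ(e^{sΛ}) − L′(1,χ)Π(d,r)·gProfile A C γ s‖ ≤ E₀`. [cite: Zhang2022LandauSiegel, §8 Lemma 8.4] -/
theorem xiRieszMean_sub_le_of_lemma84 {j μ d r : ℕ} {E₀ Λ τ Z T P : ℝ} (hΛ : 0 < Λ)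
    (h84 : ∀ y : ℝ, T < y → y < P →
      ‖(∑ n ∈ Finset.Ico 1 ⌈y⌉₊, χ (n : ZMod D) * xiZero c' D j n d r / (n : ℂ) *
            ((y / n : ℝ) : ℂ) ^ (-betaMu D μ) * (Real.log (y / n) : ℂ)) -
          deriv χ.LFunction 1 * PiW χ d r * frakgW c' D j μ y‖ ≤ E₀)
    (hτ : T < Real.exp (τ * Λ)) (hZ : Real.exp (Z * Λ) < P) :
    ∀ s ∈ Icc τ Z, ‖xiRieszMean c' χ j μ d r (Real.exp (s * Λ))
        - deriv χ.LFunction 1 * PiW χ d r *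
          gProfile (betaJ c' D (j + 1) * betaJ c' D (j + 2) / betaMu D μ ^ 2)
            (-((betaJ c' D (j + 1) - betaMu D μ) * (betaJ c' D (j + 2) - betaMu D μ)) * Λ / betaMu D μ)
            (betaMu D μ * Λ) s‖ ≤ E₀ := by
  intro s hs
  have h1 : T < Real.exp (s * Λ) :=
    lt_of_lt_of_le hτ (Real.exp_le_exp.mpr (mul_le_mul_of_nonneg_right hs.1 hΛ.le))
  have h2 : Real.exp (s * Λ) < P :=
    lt_of_le_of_lt (Real.exp_le_exp.mpr (mul_le_mul_of_nonneg_right hs.2 hΛ.le)) hZ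
  have h := h84 _ h1 h2
  rw [frakgW_exp_eq_gProfile] at h
  exact h

/-! ### `hB`: the trivial bound of the twisted Riesz mean and of the main-term profile -/

omit [NeZero D] in
/-- **Trivial bound:** `‖R^ξ(y)‖ ≤ log y·Σ_{n<⌈y⌉}‖ξ₀ⱼ(n;d,r)‖/n` for `y ≥ 1` (`|χ| ≤ 1`, `|(y/n)^{−β_μ}| = 1`,
`0 ≤ log(y/n) ≤ log y`). [cite: Zhang2022LandauSiegel, §8 p. 47] -/
theorem norm_xiRieszMean_le (c' : ℝ) (χ : DirichletCharacter ℂ D) (j μ d r : ℕ) {y : ℝ} (hy : 1 ≤ y) :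
    ‖xiRieszMean c' χ j μ d r y‖ ≤ Real.log y * ∑ n ∈ Finset.Ico 1 ⌈y⌉₊, ‖xiZero c' D j n d r‖ / n := by
  have hy0 : 0 < y := by linarith
  unfold xiRieszMean
  rw [Finset.mul_sum]
  refine (norm_sum_le _ _).trans (Finset.sum_le_sum fun n hn => ?_)
  rw [Finset.mem_Ico] at hn
  have hn1 : (1 : ℝ) ≤ n := by exact_mod_cast hn.1
  have hn0 : (0 : ℝ) < n := by linarith
  have hny : (n : ℝ) < y := by
    have h := Nat.ceil_lt_add_one hy0.le
    have : (n : ℝ) + 1 ≤ ⌈y⌉₊ := by exact_mod_cast hn.2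
    linarith
  have hyn : 1 ≤ y / n := (one_le_div hn0).mpr hny.le
  have hlog0 : 0 ≤ Real.log (y / n) := Real.log_nonneg hyn
  have hlogle : Real.log (y / n) ≤ Real.log y := by
    rw [Real.log_div hy0.ne' hn0.ne']; linarith [Real.log_nonneg hn1]
  have hpow : ‖((y / n : ℝ) : ℂ) ^ (-betaMu D μ)‖ = 1 := by
    rw [Complex.norm_cpow_eq_rpow_re_of_pos (by positivity)]
    simp [Section8PerronSteps.betaMu_re]
  rw [norm_mul, norm_mul, norm_div, norm_mul, hpow, mul_one, Complex.norm_real, Real.norm_eq_abs,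
    abs_of_nonneg hlog0, Complex.norm_natCast]
  calc ‖χ (n : ZMod D)‖ * ‖xiZero c' D j n d r‖ / n * Real.log (y / n)
      ≤ 1 * ‖xiZero c' D j n d r‖ / n * Real.log y := by
        gcongr
        exact χ.norm_le_one _
    _ = Real.log y * (‖xiZero c' D j n d r‖ / n) := by ring

/-- `‖gProfile A C γ s‖ ≤ ‖A‖ + ‖1 − A‖ + ‖C‖·s` for `s ≥ 0` and purely imaginary `γ`. [cite: Zhang2022LandauSiegel, §8 Lemma 8.4] -/
theorem norm_gProfile_le {A C γ : ℂ} (hγ : γ.re = 0) {s : ℝ} (hs : 0 ≤ s) :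
    ‖gProfile A C γ s‖ ≤ ‖A‖ + ‖1 - A‖ + ‖C‖ * s := by
  unfold gProfile
  have hexp : ‖Complex.exp (-(γ * (s : ℂ)))‖ = 1 := by
    rw [Complex.norm_exp]; simp [Complex.mul_re, hγ]
  calc ‖A + (1 - A + C * (s : ℂ)) * Complex.exp (-(γ * (s : ℂ)))‖
      ≤ ‖A‖ + ‖(1 - A + C * (s : ℂ)) * Complex.exp (-(γ * (s : ℂ)))‖ := norm_add_le _ _
    _ = ‖A‖ + ‖1 - A + C * (s : ℂ)‖ := by rw [norm_mul, hexp, mul_one]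
    _ ≤ ‖A‖ + (‖1 - A‖ + ‖C * (s : ℂ)‖) := by gcongr; exact norm_add_le _ _
    _ = ‖A‖ + ‖1 - A‖ + ‖C‖ * s := by
        rw [norm_mul, Complex.norm_real, Real.norm_eq_abs, abs_of_nonneg hs]; ring

omit [NeZero D] in
/-- **Supplier of `hB`:** on the low range `s ∈ [0, τ]` (`Λ > 0`), with `Ξ` any bound for the absolute logarithmic means
`Σ_{n<⌈y⌉}‖ξ₀ⱼ(n;d,r)‖/n`, `1 ≤ y ≤ e^{τΛ}` (the tree: `XiZeroTailMean.xiZeroTailMean`, `C𝓛(1 + log y)³` up to `T`), and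
purely imaginary `γ`: `‖R^ξ(e^{sΛ}) − M·gProfile A C γ s‖ ≤ τΛ·Ξ + ‖M‖(‖A‖ + ‖1−A‖ + ‖C‖τ)`.
[cite: Zhang2022LandauSiegel, §8 p. 47] -/
theorem xiRieszMean_low_le {j μ d r : ℕ} {Λ τ Ξ : ℝ} {M A C γ : ℂ} (hΛ : 0 < Λ) (hγ : γ.re = 0)
    (hΞ : ∀ y : ℝ, 1 ≤ y → y ≤ Real.exp (τ * Λ) → ∑ n ∈ Finset.Ico 1 ⌈y⌉₊, ‖xiZero c' D j n d r‖ / n ≤ Ξ) :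
    ∀ s ∈ Icc (0 : ℝ) τ, ‖xiRieszMean c' χ j μ d r (Real.exp (s * Λ)) - M * gProfile A C γ s‖
      ≤ τ * Λ * Ξ + ‖M‖ * (‖A‖ + ‖1 - A‖ + ‖C‖ * τ) := by
  intro s hs
  have hy1 : 1 ≤ Real.exp (s * Λ) := Real.one_le_exp (mul_nonneg hs.1 hΛ.le)
  have hyτ : Real.exp (s * Λ) ≤ Real.exp (τ * Λ) := Real.exp_le_exp.mpr (mul_le_mul_of_nonneg_right hs.2 hΛ.le)
  have hΞ0 : 0 ≤ Ξ := le_trans (Finset.sum_nonneg fun n _ => by positivity) (hΞ _ hy1 hyτ)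
  have hR := norm_xiRieszMean_le c' χ j μ d r hy1
  rw [Real.log_exp] at hR
  calc ‖xiRieszMean c' χ j μ d r (Real.exp (s * Λ)) - M * gProfile A C γ s‖
      ≤ ‖xiRieszMean c' χ j μ d r (Real.exp (s * Λ))‖ + ‖M * gProfile A C γ s‖ := norm_sub_le _ _
    _ ≤ s * Λ * Ξ + ‖M‖ * (‖A‖ + ‖1 - A‖ + ‖C‖ * s) := by
        refine add_le_add (hR.trans (mul_le_mul_of_nonneg_left (hΞ _ hy1 hyτ) (mul_nonneg hs.1 hΛ.le))) ?_
        rw [norm_mul]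
        exact mul_le_mul_of_nonneg_left (norm_gProfile_le hγ hs.1) (norm_nonneg _)
    _ ≤ τ * Λ * Ξ + ‖M‖ * (‖A‖ + ‖1 - A‖ + ‖C‖ * τ) := by
        gcongr
        · exact hs.2
        · exact hs.2

end Literature.NumberTheory.LFunctions.Zhang2022.DipoleRule

end
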